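import Mathlib
import HarnessLib
import Summits.Ventures.LatticeQCDFlow.Exactness.FlowPushforward
import Summits.Ventures.LatticeQCDFlow.Exactness.TransformedKernel
import Summits.Ventures.LatticeQCDFlow.Scaling.EntropyBudgetCoupling

/-!
# A site map swept over the lattice class by class (checkerboard) is a measurable bijection whose exact Jacobian is the product of the per-site factors evaluated on the CURRENT field — so THMC with it is exact

HONEST FRAMING: exact (Metropolis-corrected) sampling algorithms for lattice gauge theory;
figures of merit are autocorrelation/cost numbers at stated couplings and volumes; no
continuum-physics claim.

Venture `LatticeQCDFlow` (cell pub-lqcd), topic `Exactness`; FANOUT row 7 (`s0-cpn-null`: the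
S0-D1 rung — 2D CP⁹, Lüscher's leading-order trivializing map INSIDE the HMC algorithm, "THMC",
Engel–Schaefer 2011).  NEW WORK of the cell: an ASSEMBLY of the tree's own theorems —
`Exactness/FlowPushforward.lean` (`HasJacobian`, `HasJacobian.comp`),
`Scaling/EntropyBudgetCoupling.lean` (theory seat: a COUPLING LAYER `Theory2.coupleFun p ψ` —
the sites of a class `p` updated one at a time by single-site bijections depending only on the
frozen sites — has exact Jacobian `Theory2.coupleJac p j` = the product of the single-site
Jacobians, `Theory2.hasJacobian_coupleFun`; `Theory2.coupleEquiv`) and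
`Exactness/TransformedKernel.lean` (row 7: `thmc_exact`).  Nothing is cited as a fact.  Printed
counterpart, NAMED ONLY: Engel–Schaefer, Comput. Phys. Commun. 182 (2011) 2107, §3: the map
`x = F(y)` is the single-site LO step (17) applied "sweeping through the lattice", and
`S_eff = S(F(y)) − Σ_n ln det 𝒥_n` with the per-site factors (18).

## Why this file

The cell's reference implementation and row 7's production code apply the single-site step to
all sites of one parity class (whose local fields `J` depend only on the OTHER class, same-parity
sites not being neighbours), then RECOMPUTE the local fields from the updated configuration and
apply the step to the other class; the log-Jacobian they feed to the HMC force and accept step is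
the plain SUM of the per-site `ln det 𝒥_n` along this sweep ("block-triangular in visiting
order", pre-registration item (ii) of the S0-D1 card).  This file is the theorem that this sum IS
the exact Jacobian of the composite map and that THMC run with it is exact — for any two classes
`p`, `q` of sites, any single-site measurable bijections with exact single-site Jacobians, any
number of classes by iterating (`HasJacobian.iterate` for repeated steps).

## Content (`ι` a finite index set of sites, site space `G` with σ-finite reference measure `m`,
## configuration space `ι → G` with `⊗ᵢ m`; classes `p q : ι → Prop`)

* `HasJacobian.congr_jac` (bookkeeping), **`HasJacobian.iterate`** — `n` steps of a map with
  exact Jacobian `J` have exact Jacobian `∏_{k<n} J (F^[k] z)` (log-dets add along the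
  trajectory: `n_s` Euler steps).
* `sweepJac p q ψ₁ j₁ j₂ U = coupleJac q j₂ (coupleFun p ψ₁ U) · coupleJac p j₁ U` — the second
  class's factors are evaluated on the configuration AFTER the first class moved;
  **`hasJacobian_sweep`** — `coupleFun q ψ₂ ∘ coupleFun p ψ₁` has exact Jacobian `sweepJac`
  w.r.t. `⊗ᵢ m`; **`log_sweepJac`** — `log sweepJac = Σ_{a ∈ q} log j₂ a (·)(·) + Σ_{a ∈ p} log
  j₁ a (·)(·)`, the code's running sum; `sweepJac_pos`.
* `sweepEquiv` — the sweep of single-site measurable BIJECTIONS as a measurable equivalence of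
  `ι → G` (`Theory2.coupleEquiv` twice; `coe_sweepEquiv`); **`hasJacobian_sweepEquiv`**.
* **`thmc_sweep_exact`** — THMC with the swept map is exact: ANY update of the `V`-variables
  leaving `e^{−(S ∘ F − log sweepJac)} · ⊗ᵢ m` invariant (HMC for `S_eff` with accept/reject,
  whatever the integrator), reported through `F = sweepEquiv`, leaves `e^{−S} · ⊗ᵢ m` invariant
  (`TransformedKernel.thmc_exact` with `hasJacobian_sweepEquiv`); `thmc_sweep_isReversible`.

For row 7: `G = S^{2N−1}` with its normalised surface measure, `p`/`q` = even/odd sites, `ψ` =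
the LO kick `Exactness/SphereGeodesicKick.geodesicKick` at the local field built from the frozen
neighbours and the (untransformed) links, `j` = E–S eq. (18), whose polar factor is
`Exactness/KickAngleJacobian.hasJacobian_kickAngle`; the U(1) links and momenta are spectators
(`Theory2.hasJacobian_couple`, `TransformedHMC.HasJacobian.prodMap_id`).

NOT CLAIMED: the single-site sphere-level `HasJacobian` (it is the hypothesis `hJ₁`/`hJ₂`; its
assembly from the polar factor needs the axis disintegration of the sphere measure, not in the
tree); anything about which sweep order or class decomposition is better (they change the map,
not its exactness); autocorrelations.
-/

noncomputable section

open MeasureTheory ProbabilityTheory ProbabilityTheory.Kernel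
open Summit.Ventures.LatticeQCDFlow.Theory2
open scoped ENNReal

namespace Summit.Ventures.LatticeQCDFlow.Exactness

/-! ## Bookkeeping: changing the Jacobian function, iterating -/

section Iterate

variable {Ω : Type*} [MeasurableSpace Ω] {vol : Measure Ω} {F : Ω → Ω} {J J' : Ω → ℝ≥0∞}

/-- Replace the Jacobian by an equal measurable function. -/
theorem HasJacobian.congr_jac (hF : HasJacobian vol F J) (hJ' : Measurable J') (h : J = J') :
    HasJacobian vol F J' where
  measurable := hF.measurable
  measurable_jac := hJ'
  map_eq := by rw [← h]; exact hF.map_eq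

/-- **Steps compose, log-dets add along the trajectory**: if `F` has exact Jacobian `J` then
`F^[n]` has exact Jacobian `z ↦ ∏_{k<n} J (F^[k] z)` (`n` Euler steps of the same site map; more
generally `HasJacobian.comp` for different steps). -/
theorem HasJacobian.iterate (hF : HasJacobian vol F J) :
    ∀ n : ℕ, HasJacobian vol F^[n] fun z => ∏ k ∈ Finset.range n, J (F^[k] z)
  | 0 => by
    simp only [Function.iterate_zero, Finset.range_zero, Finset.prod_empty]
    exact hasJacobian_id vol
  | n + 1 => by
    have h := hF.comp (HasJacobian.iterate hF n)
    rw [Function.iterate_succ']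
    refine h.congr_jac (Finset.measurable_prod _ fun k _ =>
      hF.measurable_jac.comp (hF.measurable.iterate k)) ?_
    funext z
    rw [Finset.prod_range_succ, mul_comm]

end Iterate

/-! ## Two classes swept in turn -/

section Sweep

variable {ι : Type*} [Fintype ι] (p q : ι → Prop) [DecidablePred p] [DecidablePred q]
  {G : Type*}

/-- The Jacobian of the two-class sweep "first `p`, then `q`": the `q`-class factors are evaluated
on the configuration AFTER the `p`-class update (local fields recomputed from the current field),
times the `p`-class factors on the initial configuration. -/
def sweepJac (ψ₁ : {i // p i} → ({i // ¬p i} → G) → G → G)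
    (j₁ : {i // p i} → ({i // ¬p i} → G) → G → ℝ)
    (j₂ : {i // q i} → ({i // ¬q i} → G) → G → ℝ) (U : ι → G) : ℝ :=
  coupleJac q j₂ (coupleFun p ψ₁ U) * coupleJac p j₁ U

variable {p q}

/-- The sweep Jacobian is positive when every single-site factor is. -/
theorem sweepJac_pos {ψ₁ : {i // p i} → ({i // ¬p i} → G) → G → G}
    {j₁ : {i // p i} → ({i // ¬p i} → G) → G → ℝ}
    {j₂ : {i // q i} → ({i // ¬q i} → G) → G → ℝ}
    (hj₁0 : ∀ a y g, 0 < j₁ a y g) (hj₂0 : ∀ a y g, 0 < j₂ a y g) (U : ι → G) :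
    0 < sweepJac p q ψ₁ j₁ j₂ U :=
  mul_pos (coupleJac_pos hj₂0 _) (coupleJac_pos hj₁0 _)

/-- **The code's running sum.**  `log sweepJac = Σ_{a ∈ q} log j₂ a (frozen after step 1) (site
after step 1) + Σ_{a ∈ p} log j₁ a (frozen) (site)` — `S_eff = S(F(y)) − Σ_n ln det 𝒥_n` with the
per-site factors accumulated along the sweep. -/
theorem log_sweepJac {ψ₁ : {i // p i} → ({i // ¬p i} → G) → G → G}
    {j₁ : {i // p i} → ({i // ¬p i} → G) → G → ℝ}
    {j₂ : {i // q i} → ({i // ¬q i} → G) → G → ℝ}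
    (hj₁0 : ∀ a y g, 0 < j₁ a y g) (hj₂0 : ∀ a y g, 0 < j₂ a y g) (U : ι → G) :
    Real.log (sweepJac p q ψ₁ j₁ j₂ U) =
      (∑ a : {i // q i}, Real.log (j₂ a (fun f => coupleFun p ψ₁ U f) (coupleFun p ψ₁ U a))) +
        ∑ a : {i // p i}, Real.log (j₁ a (fun f => U f) (U a)) := by
  unfold sweepJac
  rw [Real.log_mul (coupleJac_pos hj₂0 _).ne' (coupleJac_pos hj₁0 _).ne']
  unfold coupleJac
  rw [Real.log_prod (fun a _ => (hj₂0 a _ _).ne'), Real.log_prod (fun a _ => (hj₁0 a _ _).ne')]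

variable [MeasurableSpace G] (m : Measure G) [SigmaFinite m]

/-- **The swept map has exact Jacobian `sweepJac`** w.r.t. `⊗ᵢ m`: two coupling layers composed
(`Theory2.hasJacobian_coupleFun` twice and `HasJacobian.comp`). Hypotheses per class: the
single-site maps and factors are jointly measurable in (site value, frozen part), every
single-site map has exact Jacobian = its factor w.r.t. `m`, factors nonnegative. -/
theorem hasJacobian_sweep
    {ψ₁ : {i // p i} → ({i // ¬p i} → G) → G → G} {j₁ : {i // p i} → ({i // ¬p i} → G) → G → ℝ}
    {ψ₂ : {i // q i} → ({i // ¬q i} → G) → G → G} {j₂ : {i // q i} → ({i // ¬q i} → G) → G → ℝ}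
    (hψ₁ : ∀ a, Measurable fun z : G × ({i // ¬p i} → G) => ψ₁ a z.2 z.1)
    (hj₁ : ∀ a, Measurable fun z : G × ({i // ¬p i} → G) => j₁ a z.2 z.1)
    (hJ₁ : ∀ a y, HasJacobian m (ψ₁ a y) fun g => ENNReal.ofReal (j₁ a y g))
    (hj₁0 : ∀ a y g, 0 ≤ j₁ a y g)
    (hψ₂ : ∀ a, Measurable fun z : G × ({i // ¬q i} → G) => ψ₂ a z.2 z.1)
    (hj₂ : ∀ a, Measurable fun z : G × ({i // ¬q i} → G) => j₂ a z.2 z.1)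
    (hJ₂ : ∀ a y, HasJacobian m (ψ₂ a y) fun g => ENNReal.ofReal (j₂ a y g))
    (hj₂0 : ∀ a y g, 0 ≤ j₂ a y g) :
    HasJacobian (Measure.pi fun _ : ι => m) (coupleFun q ψ₂ ∘ coupleFun p ψ₁)
      fun U => ENNReal.ofReal (sweepJac p q ψ₁ j₁ j₂ U) := by
  have h1 := hasJacobian_coupleFun (p := p) m hψ₁ hj₁ hJ₁ hj₁0
  have h2 := hasJacobian_coupleFun (p := q) m hψ₂ hj₂ hJ₂ hj₂0
  have h := h2.comp h1
  refine h.congr_jac (ENNReal.measurable_ofReal.comp ?_) ?_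
  · exact ((measurable_coupleJac hj₂).comp (measurable_coupleFun hψ₁)).mul (measurable_coupleJac hj₁)
  · funext U
    have hnn : 0 ≤ coupleJac q j₂ (coupleFun p ψ₁ U) := Finset.prod_nonneg fun a _ => hj₂0 a _ _
    simp only [sweepJac]
    rw [ENNReal.ofReal_mul hnn]

omit [Fintype ι] in
/-- **The sweep of single-site measurable bijections is a measurable bijection of `ι → G`**:
`sweepEquiv = (coupleEquiv ψ₁).trans (coupleEquiv ψ₂)` (its inverse undoes the `q`-class with
the `p`-class frozen at its NEW values, then the `p`-class). -/
def sweepEquiv (ψ₁ : {i // p i} → ({i // ¬p i} → G) → G ≃ᵐ G)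
    (hψ₁ : ∀ a, Measurable fun z : G × ({i // ¬p i} → G) => ψ₁ a z.2 z.1)
    (hψ₁s : ∀ a, Measurable fun z : G × ({i // ¬p i} → G) => (ψ₁ a z.2).symm z.1)
    (ψ₂ : {i // q i} → ({i // ¬q i} → G) → G ≃ᵐ G)
    (hψ₂ : ∀ a, Measurable fun z : G × ({i // ¬q i} → G) => ψ₂ a z.2 z.1)
    (hψ₂s : ∀ a, Measurable fun z : G × ({i // ¬q i} → G) => (ψ₂ a z.2).symm z.1) :
    (ι → G) ≃ᵐ (ι → G) :=
  (coupleEquiv ψ₁ hψ₁ hψ₁s).trans (coupleEquiv ψ₂ hψ₂ hψ₂s)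

omit [Fintype ι] in
/-- The underlying map of `sweepEquiv` is the two-class sweep. -/
theorem coe_sweepEquiv (ψ₁ : {i // p i} → ({i // ¬p i} → G) → G ≃ᵐ G)
    (hψ₁ : ∀ a, Measurable fun z : G × ({i // ¬p i} → G) => ψ₁ a z.2 z.1)
    (hψ₁s : ∀ a, Measurable fun z : G × ({i // ¬p i} → G) => (ψ₁ a z.2).symm z.1)
    (ψ₂ : {i // q i} → ({i // ¬q i} → G) → G ≃ᵐ G)
    (hψ₂ : ∀ a, Measurable fun z : G × ({i // ¬q i} → G) => ψ₂ a z.2 z.1)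
    (hψ₂s : ∀ a, Measurable fun z : G × ({i // ¬q i} → G) => (ψ₂ a z.2).symm z.1) :
    ⇑(sweepEquiv ψ₁ hψ₁ hψ₁s ψ₂ hψ₂ hψ₂s) =
      coupleFun q (fun a y g => ψ₂ a y g) ∘ coupleFun p (fun a y g => ψ₁ a y g) := rfl

/-- **`sweepEquiv` has exact Jacobian `sweepJac`.** -/
theorem hasJacobian_sweepEquiv (ψ₁ : {i // p i} → ({i // ¬p i} → G) → G ≃ᵐ G)
    (hψ₁ : ∀ a, Measurable fun z : G × ({i // ¬p i} → G) => ψ₁ a z.2 z.1)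
    (hψ₁s : ∀ a, Measurable fun z : G × ({i // ¬p i} → G) => (ψ₁ a z.2).symm z.1)
    (ψ₂ : {i // q i} → ({i // ¬q i} → G) → G ≃ᵐ G)
    (hψ₂ : ∀ a, Measurable fun z : G × ({i // ¬q i} → G) => ψ₂ a z.2 z.1)
    (hψ₂s : ∀ a, Measurable fun z : G × ({i // ¬q i} → G) => (ψ₂ a z.2).symm z.1)
    {j₁ : {i // p i} → ({i // ¬p i} → G) → G → ℝ} {j₂ : {i // q i} → ({i // ¬q i} → G) → G → ℝ}
    (hj₁ : ∀ a, Measurable fun z : G × ({i // ¬p i} → G) => j₁ a z.2 z.1)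
    (hJ₁ : ∀ a y, HasJacobian m (ψ₁ a y) fun g => ENNReal.ofReal (j₁ a y g))
    (hj₁0 : ∀ a y g, 0 ≤ j₁ a y g)
    (hj₂ : ∀ a, Measurable fun z : G × ({i // ¬q i} → G) => j₂ a z.2 z.1)
    (hJ₂ : ∀ a y, HasJacobian m (ψ₂ a y) fun g => ENNReal.ofReal (j₂ a y g))
    (hj₂0 : ∀ a y g, 0 ≤ j₂ a y g) :
    HasJacobian (Measure.pi fun _ : ι => m) (sweepEquiv ψ₁ hψ₁ hψ₁s ψ₂ hψ₂ hψ₂s)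
      fun U => ENNReal.ofReal (sweepJac p q (fun a y g => ψ₁ a y g) j₁ j₂ U) := by
  rw [coe_sweepEquiv]
  exact hasJacobian_sweep m hψ₁ hj₁ (fun a y => hJ₁ a y) hj₁0 hψ₂ hj₂ (fun a y => hJ₂ a y) hj₂0

/-- **THMC with the swept site map is exact.**  Let `F = sweepEquiv` (class `p`, then class `q`,
local fields recomputed in between), `J = sweepJac` its Jacobian (the product of the positive
per-site factors along the sweep), `S` a measurable action on `ι → G`.  Then ANY update `κ` of the
`V`-variables that leaves `e^{−S_eff(V)} · ⊗ᵢ m` invariant, `S_eff = S ∘ F − log J` — HMC for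
`S_eff` with momentum refresh, any reversible volume-preserving integrator and the accept/reject
step — reported in the variables `U = F V` leaves `e^{−S(U)} · ⊗ᵢ m` invariant.
(`TransformedKernel.thmc_exact` + `hasJacobian_sweepEquiv`.) -/
theorem thmc_sweep_exact (ψ₁ : {i // p i} → ({i // ¬p i} → G) → G ≃ᵐ G)
    (hψ₁ : ∀ a, Measurable fun z : G × ({i // ¬p i} → G) => ψ₁ a z.2 z.1)
    (hψ₁s : ∀ a, Measurable fun z : G × ({i // ¬p i} → G) => (ψ₁ a z.2).symm z.1)
    (ψ₂ : {i // q i} → ({i // ¬q i} → G) → G ≃ᵐ G)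
    (hψ₂ : ∀ a, Measurable fun z : G × ({i // ¬q i} → G) => ψ₂ a z.2 z.1)
    (hψ₂s : ∀ a, Measurable fun z : G × ({i // ¬q i} → G) => (ψ₂ a z.2).symm z.1)
    {j₁ : {i // p i} → ({i // ¬p i} → G) → G → ℝ} {j₂ : {i // q i} → ({i // ¬q i} → G) → G → ℝ}
    (hj₁ : ∀ a, Measurable fun z : G × ({i // ¬p i} → G) => j₁ a z.2 z.1)
    (hJ₁ : ∀ a y, HasJacobian m (ψ₁ a y) fun g => ENNReal.ofReal (j₁ a y g))
    (hj₁0 : ∀ a y g, 0 < j₁ a y g)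
    (hj₂ : ∀ a, Measurable fun z : G × ({i // ¬q i} → G) => j₂ a z.2 z.1)
    (hJ₂ : ∀ a y, HasJacobian m (ψ₂ a y) fun g => ENNReal.ofReal (j₂ a y g))
    (hj₂0 : ∀ a y g, 0 < j₂ a y g)
    {S : (ι → G) → ℝ} (hS : Measurable S) {κ : Kernel (ι → G) (ι → G)}
    (hκ : Invariant κ ((Measure.pi fun _ : ι => m).withDensity fun V =>
      ENNReal.ofReal (Real.exp (-(S (sweepEquiv ψ₁ hψ₁ hψ₁s ψ₂ hψ₂ hψ₂s V) -
        Real.log (sweepJac p q (fun a y g => ψ₁ a y g) j₁ j₂ V)))))) :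
    Invariant (conjKernel κ (sweepEquiv ψ₁ hψ₁ hψ₁s ψ₂ hψ₂ hψ₂s))
      ((Measure.pi fun _ : ι => m).withDensity fun U => ENNReal.ofReal (Real.exp (-S U))) :=
  thmc_exact (sweepJac_pos hj₁0 hj₂0)
    (hasJacobian_sweepEquiv m ψ₁ hψ₁ hψ₁s ψ₂ hψ₂ hψ₂s hj₁ hJ₁ (fun a y g => (hj₁0 a y g).le) hj₂ hJ₂
      fun a y g => (hj₂0 a y g).le) hS hκ

/-- … and inherits detailed balance: an `e^{−S_eff}`-reversible `V`-update reported through the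
sweep is `e^{−S}`-reversible (`TransformedKernel.thmc_isReversible`). -/
theorem thmc_sweep_isReversible (ψ₁ : {i // p i} → ({i // ¬p i} → G) → G ≃ᵐ G)
    (hψ₁ : ∀ a, Measurable fun z : G × ({i // ¬p i} → G) => ψ₁ a z.2 z.1)
    (hψ₁s : ∀ a, Measurable fun z : G × ({i // ¬p i} → G) => (ψ₁ a z.2).symm z.1)
    (ψ₂ : {i // q i} → ({i // ¬q i} → G) → G ≃ᵐ G)
    (hψ₂ : ∀ a, Measurable fun z : G × ({i // ¬q i} → G) => ψ₂ a z.2 z.1)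
    (hψ₂s : ∀ a, Measurable fun z : G × ({i // ¬q i} → G) => (ψ₂ a z.2).symm z.1)
    {j₁ : {i // p i} → ({i // ¬p i} → G) → G → ℝ} {j₂ : {i // q i} → ({i // ¬q i} → G) → G → ℝ}
    (hj₁ : ∀ a, Measurable fun z : G × ({i // ¬p i} → G) => j₁ a z.2 z.1)
    (hJ₁ : ∀ a y, HasJacobian m (ψ₁ a y) fun g => ENNReal.ofReal (j₁ a y g))
    (hj₁0 : ∀ a y g, 0 < j₁ a y g)
    (hj₂ : ∀ a, Measurable fun z : G × ({i // ¬q i} → G) => j₂ a z.2 z.1)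
    (hJ₂ : ∀ a y, HasJacobian m (ψ₂ a y) fun g => ENNReal.ofReal (j₂ a y g))
    (hj₂0 : ∀ a y g, 0 < j₂ a y g)
    {S : (ι → G) → ℝ} (hS : Measurable S) {κ : Kernel (ι → G) (ι → G)}
    (hκ : IsReversible κ ((Measure.pi fun _ : ι => m).withDensity fun V =>
      ENNReal.ofReal (Real.exp (-(S (sweepEquiv ψ₁ hψ₁ hψ₁s ψ₂ hψ₂ hψ₂s V) -
        Real.log (sweepJac p q (fun a y g => ψ₁ a y g) j₁ j₂ V)))))) :
    IsReversible (conjKernel κ (sweepEquiv ψ₁ hψ₁ hψ₁s ψ₂ hψ₂ hψ₂s))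
      ((Measure.pi fun _ : ι => m).withDensity fun U => ENNReal.ofReal (Real.exp (-S U))) :=
  thmc_isReversible (sweepJac_pos hj₁0 hj₂0)
    (hasJacobian_sweepEquiv m ψ₁ hψ₁ hψ₁s ψ₂ hψ₂ hψ₂s hj₁ hJ₁ (fun a y g => (hj₁0 a y g).le) hj₂ hJ₂
      fun a y g => (hj₂0 a y g).le) hS hκ

end Sweep

end Summit.Ventures.LatticeQCDFlow.Exactness

end
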